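import Summits.Ventures.PercRepro.ProfilePointedCircuitClassesStarSharpLoopA

/-!
# PercRepro — THE ALL-ON CORE OF `StarNineSharp` (THE LOOP REGIME OF D0), PART B: THE SHARED-ENDPOINT LEMMA
(p5, gen 55; `proofs/P5-GM1.md` §82 ADD 1 (e), ADD 2)

`cpoints_of_shared_endpoint`: on `X = {c, u, v, p, q}`, two bad demands `{c, u}`, `{c, v}` (no swap: `ρ(π + f) = 2` or
`e ∈ cl(X − π)`) whose other endpoints `u, v` are not C-points force `p` and `q` into `C`: the pair must be a B1 demand
with its non-C endpoint on the line `ef` and a B2 demand (two B1 demands would put `f` into the plane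
`cl{u, p, q} ∋ e, u`; two B2 demands would put `f, v` into `cl{c, u, p, q}` of rank 3, against `ρ({v, p, q} + f) = 4`),
and then `p ∈ cl{e, f}` would put `f` into the plane `cl(X − π) ∋ e`, while `ρ(X − p) ≤ 3` would absorb `f ∈ cl(π′)`
and `e ∈ cl{f, u}`, against `ρ(E₇ − f − p) = 4`.  This is the only failure pattern of the endpoint map `bad → C` in
the loop and parallel regimes (§82 ADD 1 (e)).
-/

open scoped Matroid

namespace PercRepro.Cogirth

open Finset ThmH Skew Shadow Profile

open Classical

variable {α : Type} [DecidableEq α] {N : Matroid α} [N.Finite]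

section StarSharpLoopB

variable {b b' : α}

/-- `{c, v, u, q} = {c, u, v, q}`. -/
theorem quad_swap23 (c u v q : α) : ({c, v, u, q} : Finset α) = {c, u, v, q} := by
  ext a; simp only [mem_insert, mem_singleton]; tauto

/-- **THE SHARED-ENDPOINT LEMMA**: two bad demands `{c, u}`, `{c, v}` on `X = {c, u, v, p, q}` whose other endpoints
`u, v` are not C-points force `p` and `q` into `C`. -/
theorem cpoints_of_shared_endpoint {e f : α} (he : e ∈ gr N) (hf : f ∈ gr N) (hef : e ≠ f) (heb : e ≠ b) (heb' : e ≠ b')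
    (he1 : ∀ y ∈ ((((gr N).erase b).erase b').erase f).erase e, rk N {e, y} = 2)
    (hf1 : ∀ y ∈ ((((gr N).erase b).erase b').erase f).erase e, rk N {f, y} = 2)
    (hfc : ∀ y ∈ ((((gr N).erase b).erase b').erase f).erase e, rk N (((((gr N).erase b).erase b').erase f).erase y) = 4)
    (hef2 : rk N {e, f} = 2)
    {c u v p q : α} (hcu : c ≠ u) (hcv : c ≠ v) (hcp : c ≠ p) (hcq : c ≠ q) (huv : u ≠ v) (hup : u ≠ p) (huq : u ≠ q)
    (hvp : v ≠ p) (hvq : v ≠ q) (hpq : p ≠ q)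
    (hu : u ∈ ((((gr N).erase b).erase b').erase f).erase e) (hv : v ∈ ((((gr N).erase b).erase b').erase f).erase e)
    (hp : p ∈ ((((gr N).erase b).erase b').erase f).erase e) (hq : q ∈ ((((gr N).erase b).erase b').erase f).erase e)
    (hXeq : ((((gr N).erase b).erase b').erase f).erase e = {c, u, v, p, q})
    (hY1 : rk N (insert e {c, u}) = 3) (hYc1 : rk N (insert f {v, p, q}) = 4)
    (hb1 : ¬ (rk N (insert f {c, u}) = 3 ∧ rk N (insert e {v, p, q}) = 4))
    (hY2 : rk N (insert e {c, v}) = 3) (hYc2 : rk N (insert f {u, p, q}) = 4)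
    (hb2 : ¬ (rk N (insert f {c, v}) = 3 ∧ rk N (insert e {u, p, q}) = 4))
    (hu' : ¬ (rk N {e, f, u} = 3 ∧ rk N {c, v, p, q} = 4))
    (hv' : ¬ (rk N {e, f, v} = 3 ∧ rk N {c, u, p, q} = 4)) :
    (rk N {e, f, p} = 3 ∧ rk N {c, u, v, q} = 4) ∧ (rk N {e, f, q} = 3 ∧ rk N {c, u, v, p} = 4) := by
  have hE7g : ((gr N).erase b).erase b' ⊆ gr N := (erase_subset _ _).trans (erase_subset _ _)
  have hXg : ((((gr N).erase b).erase b').erase f).erase e ⊆ gr N :=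
    ((erase_subset _ _).trans (erase_subset _ _)).trans hE7g
  have hc : c ∈ ((((gr N).erase b).erase b').erase f).erase e := by rw [hXeq]; exact mem_insert_self _ _
  have hcg := hXg hc
  have hug := hXg hu
  have hvg := hXg hv
  have hpg := hXg hp
  have hqg := hXg hq
  have hcu2 := rk_pair_eq_two_of_insert_e he hcg hug hY1
  have hcv2 := rk_pair_eq_two_of_insert_e he hcg hvg hY2
  have hvpq3 := rk_triple_eq_three_of_insert_f hf hvg hpg hqg hYc1
  have hupq3 := rk_triple_eq_three_of_insert_f hf hug hpg hqg hYc2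
  -- the ranges of the R0 ranks
  have hfcu_lo : rk N ({c, u} : Finset α) ≤ rk N (insert f ({c, u} : Finset α)) := rk_mono' (subset_insert _ _)
  have hfcu_hi := rk_insert_le_add_one (N := N) hf (X := ({c, u} : Finset α)) (by
    intro a ha; simp only [mem_insert, mem_singleton] at ha; rcases ha with rfl | rfl <;> assumption)
  have hfcv_lo : rk N ({c, v} : Finset α) ≤ rk N (insert f ({c, v} : Finset α)) := rk_mono' (subset_insert _ _)
  have hfcv_hi := rk_insert_le_add_one (N := N) hf (X := ({c, v} : Finset α)) (by
    intro a ha; simp only [mem_insert, mem_singleton] at ha; rcases ha with rfl | rfl <;> assumption)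
  have hevpq_lo : rk N ({v, p, q} : Finset α) ≤ rk N (insert e ({v, p, q} : Finset α)) := rk_mono' (subset_insert _ _)
  have hevpq_hi := rk_insert_le_add_one (N := N) he (X := ({v, p, q} : Finset α)) (by
    intro a ha; simp only [mem_insert, mem_singleton] at ha; rcases ha with rfl | rfl | rfl <;> assumption)
  have heupq_lo : rk N ({u, p, q} : Finset α) ≤ rk N (insert e ({u, p, q} : Finset α)) := rk_mono' (subset_insert _ _)
  have heupq_hi := rk_insert_le_add_one (N := N) he (X := ({u, p, q} : Finset α)) (by
    intro a ha; simp only [mem_insert, mem_singleton] at ha; rcases ha with rfl | rfl | rfl <;> assumption)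
  -- the ranges of `ρ{e, f, u}`, `ρ{e, f, v}`
  have hefu_lo : rk N ({e, u} : Finset α) ≤ rk N ({e, f, u} : Finset α) := rk_mono' (pair_et_subset_eft e f u)
  have hefu_hi := rk_insert_le_add_one (N := N) hug (X := ({e, f} : Finset α)) (by
    intro a ha; simp only [mem_insert, mem_singleton] at ha; rcases ha with rfl | rfl <;> assumption)
  rw [← triple_eq_insert_last, hef2] at hefu_hi
  rw [he1 u hu] at hefu_lo
  have hefv_lo : rk N ({e, v} : Finset α) ≤ rk N ({e, f, v} : Finset α) := rk_mono' (pair_et_subset_eft e f v)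
  have hefv_hi := rk_insert_le_add_one (N := N) hvg (X := ({e, f} : Finset α)) (by
    intro a ha; simp only [mem_insert, mem_singleton] at ha; rcases ha with rfl | rfl <;> assumption)
  rw [← triple_eq_insert_last, hef2] at hefv_hi
  rw [he1 v hv] at hefv_lo
  -- the rank-4 sets `E₇ − f − p`, `E₇ − f − q`
  have hEp : rk N (insert e ({c, u, v, q} : Finset α)) = 4 := by
    have := hfc p hp
    rw [← insert_e_X_erase_eq he hef heb heb' hp, hXeq, quint_erase_fourth hcp hup hvp hpq] at this
    exact this
  have hEq : rk N (insert e ({c, u, v, p} : Finset α)) = 4 := by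
    have := hfc q hq
    rw [← insert_e_X_erase_eq he hef heb heb' hq, hXeq, quint_erase_fifth hcq huq hvq hpq] at this
    exact this
  -- the B1 facts
  have hK1 : rk N (insert e ({v, p, q} : Finset α)) = 3 → rk N ({c, v, p, q} : Finset α) = 4 := fun hB1 =>
    rk_quad_eq_four_of_B1 he hf hef heb heb' hfc hcu huv hup huq hu hXeq hYc1 hB1
  have hK1' : rk N (insert e ({u, p, q} : Finset α)) = 3 → rk N ({c, u, p, q} : Finset α) = 4 := by
    intro hB1
    have hXeq' : ((((gr N).erase b).erase b').erase f).erase e = {c, v, u, q, p} := by rw [hXeq, quint_swap_uv_pq]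
    have := rk_quad_eq_four_of_B1 he hf hef heb heb' hfc hcv huv.symm hvq hvp hv hXeq'
      (by rw [triple_swap23]; exact hYc2) (by rw [triple_swap23]; exact hB1)
    rw [quad_swap34] at this
    exact this
  -- the B2 facts
  have hK2 : rk N (insert f ({c, u} : Finset α)) = 2 → rk N ({e, f, u} : Finset α) = 3 := fun hB2 =>
    rk_eft_eq_three_of_B2 he hf hf1 hef2 hu hY1 hB2
  have hK2' : rk N (insert f ({c, v} : Finset α)) = 2 → rk N ({e, f, v} : Finset α) = 3 := fun hB2 =>
    rk_eft_eq_three_of_B2 he hf hf1 hef2 hv hY2 hB2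
  -- the conclusions from a B1 demand `{c, u}` (`u` on `ef`) and a B2 demand `{c, v}` (`f ∈ cl{c, v}`)
  have hconc : ∀ u₀ v₀ : α, u₀ ∈ gr N → v₀ ∈ gr N → rk N {e, u₀} = 2 → rk N {f, u₀} = 2 →
      rk N (insert e {v₀, p, q}) = 3 → rk N (insert f {v₀, p, q}) = 4 → rk N {c, v₀} = 2 →
      rk N (insert f {c, v₀}) = 2 → rk N {e, f, u₀} = 2 →
      rk N (insert e ({c, u₀, v₀, q} : Finset α)) = 4 → rk N (insert e ({c, u₀, v₀, p} : Finset α)) = 4 →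
      (rk N {e, f, p} = 3 ∧ rk N {c, u₀, v₀, q} = 4) ∧ (rk N {e, f, q} = 3 ∧ rk N {c, u₀, v₀, p} = 4) := by
    intro u₀ v₀ hu₀g hv₀g heu₀ hfu₀ hB1 hYc hcv₀ hB2 hefu₀ hEp₀ hEq₀
    -- `e ∈ cl{f, u₀}` and `f ∈ cl{c, v₀}`
    have he_fu : rk N (insert e ({f, u₀} : Finset α)) = rk N ({f, u₀} : Finset α) := by
      rw [insert_pair_eq_first, hefu₀, hfu₀]
    have hf_cv : rk N (insert f ({c, v₀} : Finset α)) = rk N ({c, v₀} : Finset α) := by rw [hB2, hcv₀]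
    have hefp : rk N ({e, f, p} : Finset α) = 3 := by
      by_contra hne
      have h2 : rk N ({e, f, p} : Finset α) = 2 := by
        have h1 : rk N ({e, f} : Finset α) ≤ rk N ({e, f, p} : Finset α) := rk_mono' (pair_ef_subset_eft e f p)
        have h3 := rk_insert_le_add_one (N := N) hpg (X := ({e, f} : Finset α)) (by
          intro a ha; simp only [mem_insert, mem_singleton] at ha; rcases ha with rfl | rfl <;> assumption)
        rw [← triple_eq_insert_last] at h3
        rw [hef2] at h1 h3
        omega
      exact not_on_line_ef_of_plane (N := N) hB1 hYc (pair_ep_subset_insert_e_triple e v₀ p q) (he1 p hp) h2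
    have hefq : rk N ({e, f, q} : Finset α) = 3 := by
      by_contra hne
      have h2 : rk N ({e, f, q} : Finset α) = 2 := by
        have h1 : rk N ({e, f} : Finset α) ≤ rk N ({e, f, q} : Finset α) := rk_mono' (pair_ef_subset_eft e f q)
        have h3 := rk_insert_le_add_one (N := N) hqg (X := ({e, f} : Finset α)) (by
          intro a ha; simp only [mem_insert, mem_singleton] at ha; rcases ha with rfl | rfl <;> assumption)
        rw [← triple_eq_insert_last] at h3
        rw [hef2] at h1 h3
        omega
      exact not_on_line_ef_of_plane (N := N) hB1 hYc (pair_eq_subset_insert_e_triple e v₀ p q) (he1 q hq) h2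
    have hXp : rk N ({c, u₀, v₀, q} : Finset α) = 4 := by
      by_contra hne
      have hle : rk N ({c, u₀, v₀, q} : Finset α) ≤ 3 := by
        have h1 := rk_le_card' (M := N) ({c, u₀, v₀, q} : Finset α)
        have h2 : ({c, u₀, v₀, q} : Finset α).card ≤ 4 := by
          calc ({c, u₀, v₀, q} : Finset α).card ≤ ({u₀, v₀, q} : Finset α).card + 1 := card_insert_le _ _
            _ ≤ ({v₀, q} : Finset α).card + 1 + 1 := by gcongr; exact card_insert_le _ _
            _ ≤ ({q} : Finset α).card + 1 + 1 + 1 := by gcongr; exact card_insert_le _ _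
            _ = 4 := by rw [card_singleton]
        omega
      have hfS := rk_insert_eq_of_rk_insert_eq_subset' (N := N) (S := ({c, v₀} : Finset α))
        (S' := ({c, u₀, v₀, q} : Finset α)) (w := f) (pair_cv_subset_quad c u₀ v₀ q) hf_cv
      have heS := rk_insert_eq_of_rk_insert_eq_subset' (N := N) (S := ({f, u₀} : Finset α))
        (S' := insert f ({c, u₀, v₀, q} : Finset α)) (w := e) (pair_fu_subset_insert_f_quad f c u₀ v₀ q) he_fu
      exact not_rank_four_subset_of_absorb (N := N) hle hfS heS hEp₀ (insert_e_subset_insert_e_insert_f e f _)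
    have hXq : rk N ({c, u₀, v₀, p} : Finset α) = 4 := by
      by_contra hne
      have hle : rk N ({c, u₀, v₀, p} : Finset α) ≤ 3 := by
        have h1 := rk_le_card' (M := N) ({c, u₀, v₀, p} : Finset α)
        have h2 : ({c, u₀, v₀, p} : Finset α).card ≤ 4 := by
          calc ({c, u₀, v₀, p} : Finset α).card ≤ ({u₀, v₀, p} : Finset α).card + 1 := card_insert_le _ _
            _ ≤ ({v₀, p} : Finset α).card + 1 + 1 := by gcongr; exact card_insert_le _ _
            _ ≤ ({p} : Finset α).card + 1 + 1 + 1 := by gcongr; exact card_insert_le _ _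
            _ = 4 := by rw [card_singleton]
        omega
      have hfS := rk_insert_eq_of_rk_insert_eq_subset' (N := N) (S := ({c, v₀} : Finset α))
        (S' := ({c, u₀, v₀, p} : Finset α)) (w := f) (pair_cv_subset_quad c u₀ v₀ p) hf_cv
      have heS := rk_insert_eq_of_rk_insert_eq_subset' (N := N) (S := ({f, u₀} : Finset α))
        (S' := insert f ({c, u₀, v₀, p} : Finset α)) (w := e) (pair_fu_subset_insert_f_quad f c u₀ v₀ p) he_fu
      exact not_rank_four_subset_of_absorb (N := N) hle hfS heS hEq₀ (insert_e_subset_insert_e_insert_f e f _)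
    exact ⟨⟨hefp, hXp⟩, ⟨hefq, hXq⟩⟩
  -- the case split on the types of the two demands
  have hT1 : rk N (insert f ({c, u} : Finset α)) = 2 ∨ rk N (insert e ({v, p, q} : Finset α)) = 3 := by
    by_contra hne
    push Not at hne
    exact hb1 ⟨by omega, by omega⟩
  have hT2 : rk N (insert f ({c, v} : Finset α)) = 2 ∨ rk N (insert e ({u, p, q} : Finset α)) = 3 := by
    by_contra hne
    push Not at hne
    exact hb2 ⟨by omega, by omega⟩
  rcases hT1 with hB2u | hB1u <;> rcases hT2 with hB2v | hB1v
  · -- (B2, B2): `f, v ∈ cl{c, u, p, q}` of rank 3, against `ρ({v, p, q} + f) = 4`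
    exfalso
    have hefv3 := hK2' hB2v
    have hle : rk N ({c, u, p, q} : Finset α) ≤ 3 := by
      have h1 : ¬ rk N ({c, u, p, q} : Finset α) = 4 := fun h' => hv' ⟨hefv3, h'⟩
      have h2 := rk_le_card' (M := N) ({c, u, p, q} : Finset α)
      have h3 : ({c, u, p, q} : Finset α).card ≤ 4 := by
        calc ({c, u, p, q} : Finset α).card ≤ ({u, p, q} : Finset α).card + 1 := card_insert_le _ _
          _ ≤ ({p, q} : Finset α).card + 1 + 1 := by gcongr; exact card_insert_le _ _
          _ ≤ ({q} : Finset α).card + 1 + 1 + 1 := by gcongr; exact card_insert_le _ _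
          _ = 4 := by rw [card_singleton]
      omega
    have hf_cu : rk N (insert f ({c, u} : Finset α)) = rk N ({c, u} : Finset α) := by rw [hB2u, hcu2]
    have hfS := rk_insert_eq_of_rk_insert_eq_subset' (N := N) (S := ({c, u} : Finset α))
      (S' := ({c, u, p, q} : Finset α)) (w := f) (pair_cu_subset_quad c u p q) hf_cu
    -- `v ∈ cl{c, f}`
    have hv_cf : rk N (insert v ({c, f} : Finset α)) = rk N ({c, f} : Finset α) := by
      rw [pair_comm' c f, insert_pair_eq_last', hB2v, hf1 c hc]
    have hvS := rk_insert_eq_of_rk_insert_eq_subset' (N := N) (S := ({c, f} : Finset α))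
      (S' := insert f ({c, u, p, q} : Finset α)) (w := v) (pair_cf_subset_insert_f_quad f c u p q) hv_cf
    have h4 : rk N (insert f ({v, p, q} : Finset α)) ≤ rk N (insert v (insert f ({c, u, p, q} : Finset α))) :=
      rk_mono' (insert_f_triple_subset f c u v p q)
    rw [hYc1, hvS, hfS] at h4
    omega
  · -- (B2 for `{c, u}`, B1 for `{c, v}`): the roles of `u` and `v` are swapped
    have hefv2 : rk N ({e, f, v} : Finset α) = 2 := by
      have h := hK1' hB1v
      have : ¬ rk N ({e, f, v} : Finset α) = 3 := fun h' => hv' ⟨h', h⟩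
      omega
    have := hconc v u hvg hug (he1 v hv) (hf1 v hv) hB1v hYc2 hcu2 hB2u hefv2
      (by rw [quad_swap23]; exact hEp) (by rw [quad_swap23]; exact hEq)
    obtain ⟨⟨h1, h2⟩, h3, h4⟩ := this
    rw [quad_swap23] at h2 h4
    exact ⟨⟨h1, h2⟩, h3, h4⟩
  · -- (B1 for `{c, u}`, B2 for `{c, v}`)
    have hefu2 : rk N ({e, f, u} : Finset α) = 2 := by
      have h := hK1 hB1u
      have : ¬ rk N ({e, f, u} : Finset α) = 3 := fun h' => hu' ⟨h', h⟩
      omega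
    exact hconc u v hug hvg (he1 u hu) (hf1 u hu) hB1u hYc1 hcv2 hB2v hefu2 hEp hEq
  · -- (B1, B1): `f ∈ cl{e, u} ⊆ cl({u, p, q} + e)`, against `ρ({u, p, q} + f) = 4`
    exfalso
    have hefu2 : rk N ({e, f, u} : Finset α) = 2 := by
      have h := hK1 hB1u
      have : ¬ rk N ({e, f, u} : Finset α) = 3 := fun h' => hu' ⟨h', h⟩
      omega
    exact not_on_line_ef_of_plane (N := N) hB1v hYc2 (pair_subset_insert_triple e u p q) (he1 u hu) hefu2

end StarSharpLoopB

end PercRepro.Cogirth
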